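import Summits.Ventures.YMGap.RobustBall.ThreePointDecayS
import HarnessLib

/-!
# Venture YMGap, track ROBUST-BALL (Y2) — TIER 2, «C-SMOOTH-BALL» (i): PRODUCTS OF LOCAL SLOTS AND ONE DOBRUSHIN SPLIT OF THEIR
# MOMENTS, UNIFORMLY ON THE WEIGHTED BALL

HONEST FRAMING. WHAT THIS IS: a venture file (cell `pub-ymgap`, track Y2 ROBUST-BALL, seat rb-p1, theorems only).  First file of the all-orders
rung «C-SMOOTH-BALL» of the regularity ladder of the state map on the weighted ball (`StateDerivativeOnBallS` `C¹`, `StateSecondDerivativeS`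
`C²`, `StateThirdDerivativeS` `C³`): the measure-specific input of ds-1's anchored-cumulant algebra (`Thresholds/CumulantRecursion`,
split lemma `abs_ac_le_of_split`) on the ball.  A SLOT FAMILY is `X : ℕ → (configurations → ℝ)` with, for every index `i` of a finite set
`S`, a support `Δ i`, a bound `M i ≥ 0`, and a Frobenius-Lipschitz vector `δ i` (`S i := Σ_{y ∈ Δ i} δ i y`):
* `dependsOn_prod_slots`, `abs_prod_slots_le`, ★ `exists_isLipBound_prod_slots` — the product `∏_{i ∈ T} X i` is local on `⋃_{i∈T} Δ i`,
  bounded by `∏ M i`, and Frobenius-Lipschitz with a vector of total mass `≤ ∏_{i ∈ T} (M i + S i)` (induction on `T`, ds-1's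
  `isLipschitzCylinder_prod` re-done for the comparison-metric Lipschitz vectors of this lane);
* `exists_radial_gap` — the RADIAL PIGEONHOLE used by the sibling: finitely many intervals `[lo_i, hi_i]` above a base `D` with
  `max hi ≥ D + Σ (hi_i − lo_i) + nθ` admit a cut radius `u ≥ D` with every interval below `u` or above `u + θ` and the far side occupied;
  `centred_data` — centring a local Lipschitz observable at the unit configuration (`|h − h(1)| ≤ 2√N Σδ`);
* ★★ `abs_moment_split_le_S` — ONE SPLIT ON THE BALL: member `W ∈ Ball(a, Λ_t, t)` inside the one-link pair door
  `ρ := 6(d−1)|β| e^{a} e^{t} √(cv) + e^{a/2} √c Λ_t < 1`, ANY DLR state `μ`, a cut `p` of the slot indices whose two sides have supports at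
  mutual `ℓ^∞` distance `≥ g` (any real `g`): for every `T ⊆ S`,
  `|E_μ ∏_T X − E_μ ∏_{T ∩ p} X · E_μ ∏_{T ∖ p} X| ≤ 8N e^{−t g} ∏_{i ∈ T} (M i + S i)` — the difference is the covariance of the two product
  slots, clustered by the pair door's covariance bound `abs_cov_le_of_isLipBound_S`.  This is exactly the hypothesis `hsplit` of
  `Cumulants.abs_ac_le_of_split`, consumed by the sibling `TruncatedDecayS` (decay of the truncated functions of every order on the ball).
WHAT THIS IS NOT: no cumulant appears here; lattice strong coupling; one-sided Dobrushin-comparison constants; nothing continuum / Clay.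
References (mechanism only): M. Duneau, D. Iagolnitzer, B. Souillard, CMP 31 (1973) 191; R. L. Dobrushin, S. B. Shlosman (1985/87).
-/

noncomputable section

open MeasureTheory Function Finset ProbabilityTheory Real
open scoped NNReal
open Literature.Probability.LatticeModels
open Literature.Probability.LatticeModels.DobrushinMetric
open Literature.MathematicalPhysics.QuantumLattice
open Literature.MathematicalPhysics.QuantumFieldTheory hiding ZdEdge
open Summit.Ventures.YMGap.CouplingResponse (covariance_eq_sub_of_abs_le)

namespace Summit.Ventures.YMGap.RobustBall

variable {d N : ℕ}

/-! ### Products of local slots -/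

section Slots

variable {G : Type*} {r : G → G → ℝ} {X : ℕ → (ZdEdge d → G) → ℝ} {Δ : ℕ → Finset (ZdEdge d)} {M : ℕ → ℝ}
  {δ : ℕ → ZdEdge d → ℝ}

/-- A product of slots depending on `Δ i` depends on `⋃_{i ∈ T} Δ i`. -/
theorem dependsOn_prod_slots [DecidableEq (ZdEdge d)] {T : Finset ℕ} (hdep : ∀ i ∈ T, DependsOn (X i) (↑(Δ i) : Set (ZdEdge d))) :
    DependsOn (fun σ => ∏ i ∈ T, X i σ) (↑(T.biUnion Δ) : Set (ZdEdge d)) := fun σ τ h =>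
  Finset.prod_congr rfl fun i hi => hdep i hi fun y hy => h y (by
    simp only [Finset.coe_biUnion, Finset.mem_coe, Set.mem_iUnion, exists_prop]
    exact ⟨i, hi, hy⟩)

/-- A product of slots bounded by `M i` is bounded by `∏ M i`. -/
theorem abs_prod_slots_le {T : Finset ℕ} (hM : ∀ i ∈ T, ∀ σ, |X i σ| ≤ M i) (σ : ZdEdge d → G) :
    |∏ i ∈ T, X i σ| ≤ ∏ i ∈ T, M i := by
  rw [Finset.abs_prod]
  exact Finset.prod_le_prod (fun i _ => abs_nonneg _) fun i hi => hM i hi σ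

/-- A constant slot bound is nonnegative. -/
theorem slotBound_nonneg {T : Finset ℕ} (hM : ∀ i ∈ T, ∀ σ, |X i σ| ≤ M i) (σ : ZdEdge d → G) : ∀ i ∈ T, 0 ≤ M i :=
  fun i hi => (abs_nonneg _).trans (hM i hi σ)

/-- ★ **Lipschitz vector of a product of local slots.**  If `r ≥ 0` and every slot `i ∈ T` depends on `Δ i`, is bounded by `M i` and has
Lipschitz vector `δ i`, then `∏_{i∈T} X i` has a Lipschitz vector `δT ≥ 0` of total mass `Σ_{y ∈ ⋃ Δ} δT y ≤ ∏_{i∈T} (M i + Σ_{Δ i} δ i)`. -/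
theorem exists_isLipBound_prod_slots [DecidableEq (ZdEdge d)] (hr : ∀ a b, 0 ≤ r a b) (σ₀ : ZdEdge d → G) {T : Finset ℕ}
    (hdep : ∀ i ∈ T, DependsOn (X i) (↑(Δ i) : Set (ZdEdge d))) (hM : ∀ i ∈ T, ∀ σ, |X i σ| ≤ M i)
    (hδ : ∀ i ∈ T, IsLipBound r (X i) (δ i)) :
    ∃ δT : ZdEdge d → ℝ, IsLipBound r (fun σ => ∏ i ∈ T, X i σ) δT ∧
      ∑ y ∈ T.biUnion Δ, δT y ≤ ∏ i ∈ T, (M i + ∑ y ∈ Δ i, δ i y) := by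
  classical
  induction T using Finset.induction_on with
  | empty =>
    refine ⟨fun _ => 0, ⟨fun _ => le_rfl, fun y σ τ _ => ?_⟩, by simp⟩
    simp only [Finset.prod_empty, sub_self, abs_zero, zero_mul, le_refl]
  | insert i T hiT ih =>
    have hdep' : ∀ j ∈ T, DependsOn (X j) (↑(Δ j) : Set (ZdEdge d)) := fun j hj => hdep j (Finset.mem_insert_of_mem hj)
    have hM' : ∀ j ∈ T, ∀ σ, |X j σ| ≤ M j := fun j hj => hM j (Finset.mem_insert_of_mem hj)
    have hδ' : ∀ j ∈ T, IsLipBound r (X j) (δ j) := fun j hj => hδ j (Finset.mem_insert_of_mem hj)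
    obtain ⟨δT, hδT, hsum⟩ := ih hdep' hM' hδ'
    have hi : i ∈ insert i T := Finset.mem_insert_self i T
    have hMi0 : 0 ≤ M i := (abs_nonneg _).trans (hM i hi σ₀)
    have hMT0 : 0 ≤ ∏ j ∈ T, M j := Finset.prod_nonneg fun j hj => (abs_nonneg _).trans (hM' j hj σ₀)
    have hprodT := abs_prod_slots_le hM'
    have hlip := isLipBound_mul_restrict hr (hdep i hi) (dependsOn_prod_slots hdep') (hM i hi) hprodT hMi0 hMT0 (hδ i hi) hδT
    refine ⟨_, ⟨hlip.nonneg, fun y σ τ hστ => ?_⟩, ?_⟩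
    · have h := hlip.le y σ τ hστ
      simpa only [Finset.prod_insert hiT] using h
    · rw [Finset.biUnion_insert, sum_union_mul_restrict, Finset.prod_insert hiT]
      have hS0 : 0 ≤ ∑ y ∈ Δ i, δ i y := Finset.sum_nonneg fun y _ => (hδ i hi).nonneg y
      have hδT0 : 0 ≤ ∑ y ∈ T.biUnion Δ, δT y := Finset.sum_nonneg fun y _ => hδT.nonneg y
      have hPT : ∏ j ∈ T, M j ≤ ∏ j ∈ T, (M j + ∑ y ∈ Δ j, δ j y) :=
        Finset.prod_le_prod (fun j hj => (abs_nonneg _).trans (hM' j hj σ₀)) fun j hj =>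
          le_add_of_nonneg_right (Finset.sum_nonneg fun y _ => (hδ' j hj).nonneg y)
      have hP0 : 0 ≤ ∏ j ∈ T, (M j + ∑ y ∈ Δ j, δ j y) := hMT0.trans hPT
      calc M i * ∑ y ∈ T.biUnion Δ, δT y + (∏ j ∈ T, M j) * ∑ y ∈ Δ i, δ i y
          ≤ M i * ∏ j ∈ T, (M j + ∑ y ∈ Δ j, δ j y) + (∏ j ∈ T, (M j + ∑ y ∈ Δ j, δ j y)) * ∑ y ∈ Δ i, δ i y :=
            add_le_add (mul_le_mul_of_nonneg_left hsum hMi0) (mul_le_mul_of_nonneg_right hPT hS0)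
        _ = (M i + ∑ y ∈ Δ i, δ i y) * ∏ j ∈ T, (M j + ∑ y ∈ Δ j, δ j y) := by ring

/-- A function depending on no link is constant. -/
theorem eq_const_of_dependsOn_empty {f : (ZdEdge d → G) → ℝ} (h : DependsOn f (↑(∅ : Finset (ZdEdge d)) : Set (ZdEdge d)))
    (σ τ : ZdEdge d → G) : f σ = f τ :=
  h fun y hy => absurd hy (by simp)

end Slots

/-! ### The radial pigeonhole -/

/-- ★ **Radial pigeonhole.**  Finitely many intervals `[lo i, hi i]` (`lo i ≤ hi i`), a base `D`, a step `θ > 0`, and an index `i₀ ∈ s` with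
`D + Σ_{i∈s} (hi i − lo i) + #s·θ ≤ hi i₀`: then there is a cut radius `u ≥ D` such that every interval lies below `u` or above `u + θ`, and some
interval lies above `u + θ`. -/
theorem exists_radial_gap {ι : Type*} [DecidableEq ι] {lo hi : ι → ℝ} {θ : ℝ} (hθ : 0 < θ) :
    ∀ (s : Finset ι) (D : ℝ) (i₀ : ι), i₀ ∈ s → (∀ i ∈ s, lo i ≤ hi i) →
      D + ∑ i ∈ s, (hi i - lo i) + s.card * θ ≤ hi i₀ →
      ∃ u : ℝ, D ≤ u ∧ (∀ i ∈ s, hi i ≤ u ∨ u + θ ≤ lo i) ∧ ∃ j ∈ s, u + θ ≤ lo j := by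
  intro s
  induction s using Finset.strongInduction with
  | H s ih =>
    intro D i₀ hi₀ hle hsum
    have hsp0 : ∀ i ∈ s, 0 ≤ hi i - lo i := fun i hi => sub_nonneg.2 (hle i hi)
    have hS0 : 0 ≤ ∑ i ∈ s, (hi i - lo i) := Finset.sum_nonneg hsp0
    have hcard : (1 : ℝ) ≤ s.card := by exact_mod_cast Finset.card_pos.2 ⟨i₀, hi₀⟩
    have hhi₀ : D + θ ≤ hi i₀ := by nlinarith
    by_cases hgood : ∀ i ∈ s, hi i ≤ D ∨ D + θ ≤ lo i
    · refine ⟨D, le_rfl, hgood, i₀, hi₀, ?_⟩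
      rcases hgood i₀ hi₀ with h | h
      · linarith
      · exact h
    · simp only [not_forall, not_or, not_le, exists_prop] at hgood
      obtain ⟨i₁, hi₁, hD1, hlo1⟩ := hgood
      -- the bad interval is not the top one
      have hθs : θ ≤ s.card * θ := le_mul_of_one_le_left hθ.le hcard
      have hne : i₁ ≠ i₀ := by
        rintro rfl
        have h1 : hi i₁ - lo i₁ ≤ ∑ i ∈ s, (hi i - lo i) := Finset.single_le_sum hsp0 hi₁
        linarith
      set s' := s.erase i₁ with hs'
      have hss : s' ⊂ s := Finset.erase_ssubset hi₁
      have hi₀' : i₀ ∈ s' := Finset.mem_erase.2 ⟨hne.symm, hi₀⟩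
      have hsum' : hi i₁ + ∑ i ∈ s', (hi i - lo i) + s'.card * θ ≤ hi i₀ := by
        have e1 : ∑ i ∈ s, (hi i - lo i) = (hi i₁ - lo i₁) + ∑ i ∈ s', (hi i - lo i) :=
          (Finset.add_sum_erase s _ hi₁).symm
        have e2 : (s.card : ℝ) = s'.card + 1 := by
          rw [hs', Finset.card_erase_of_mem hi₁]
          have : 1 ≤ s.card := Finset.card_pos.2 ⟨i₁, hi₁⟩
          push_cast [Nat.cast_sub this]
          ring
        rw [e1, e2] at hsum
        nlinarith
      obtain ⟨u, hu, hall, j, hj, hju⟩ := ih s' hss (hi i₁) i₀ hi₀' (fun i hi => hle i (Finset.mem_of_mem_erase hi)) hsum'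
      refine ⟨u, hD1.le.trans hu, fun i hi => ?_, j, Finset.mem_of_mem_erase hj, hju⟩
      by_cases hii : i = i₁
      · subst hii; exact Or.inl hu
      · exact hall i (Finset.mem_erase.2 ⟨hii, hi⟩)

/-! ### One split of the moments on the ball -/

section SUN

variable {W : Potential (ZdEdge d) (Matrix.specialUnitaryGroup (Fin N) ℂ)}

/-- ★★ **ONE DOBRUSHIN SPLIT OF THE MOMENTS OF A SLOT FAMILY, UNIFORMLY ON THE WEIGHTED BALL.**  Member `W ∈ Ball(a, Λ_t, t)` inside the
pair door `ρ < 1`, ANY DLR state `μ`; slots `X i` (`i ∈ S`) measurable, local on `Δ i`, bounded by `M i`, Frobenius-Lipschitz vectors `δ i`; a cut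
`p` of the indices such that every link of a `p`-slot and every link of a `¬p`-slot are at `ℓ^∞` distance `≥ g`.  Then for every `T ⊆ S`:
`|∫ ∏_T X dμ − (∫ ∏_{T.filter p} X dμ)(∫ ∏_{T.filter ¬p} X dμ)| ≤ 8N e^{−t g} ∏_{i∈T} (M i + Σ_{Δ i} δ i)`. -/
theorem abs_moment_split_le_S (hd : 1 ≤ d) (hN : 1 ≤ N) {β b c v a Λt t : ℝ}
    (hc : 0 ≤ c) (hv : 0 ≤ v) (hb : |β| * (2 * ((d : ℝ) - 1)) ≤ b)
    (hP : ∀ B : Matrix (Fin N) (Fin N) ℂ, matrixOpNorm B ≤ b →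
      ∀ (ψ : Matrix.specialUnitaryGroup (Fin N) ℂ → ℝ) (M : ℝ), 0 ≤ M →
        (∀ x y, |ψ x - ψ y| ≤ M * suFrobDist x y) →
        Var[ψ; (haarProbability (Matrix.specialUnitaryGroup (Fin N) ℂ)).tilted
          fun g => (N : ℝ) * ((g : Matrix (Fin N) (Fin N) ℂ) * B).trace.re] ≤ c * M ^ 2)
    (hVB : ∀ B : Matrix (Fin N) (Fin N) ℂ, matrixOpNorm B ≤ b → ∀ Δ : Matrix (Fin N) (Fin N) ℂ,
      Var[fun g : Matrix.specialUnitaryGroup (Fin N) ℂ =>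
          (N : ℝ) * ((g : Matrix (Fin N) (Fin N) ℂ) * Δ).trace.re;
        (haarProbability (Matrix.specialUnitaryGroup (Fin N) ℂ)).tilted
          fun g => (N : ℝ) * ((g : Matrix (Fin N) (Fin N) ℂ) * B).trace.re] ≤ v * frobNorm Δ ^ 2)
    (ht : 0 ≤ t) (hρ : 6 * ((d : ℝ) - 1) * |β| * (exp a * exp t * Real.sqrt (c * v)) + exp (a / 2) * Real.sqrt c * Λt < 1)
    (hW : MemBallZdS a Λt t W) {μ : Measure (LGConfig d (Matrix.specialUnitaryGroup (Fin N) ℂ))}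
    (hμ : μ ∈ perturbedGibbsMeasuresS (d := d) (fundamentalRep (Fin N)) (N * β) W)
    {S : Finset ℕ} {X : ℕ → LGConfig d (Matrix.specialUnitaryGroup (Fin N) ℂ) → ℝ} {Δ : ℕ → Finset (ZdEdge d)} {M : ℕ → ℝ}
    {δ : ℕ → ZdEdge d → ℝ} (hXm : ∀ i ∈ S, Measurable (X i)) (hXdep : ∀ i ∈ S, DependsOn (X i) (↑(Δ i) : Set (ZdEdge d)))
    (hXM : ∀ i ∈ S, ∀ σ, |X i σ| ≤ M i) (hXδ : ∀ i ∈ S, IsLipBound suFrobDist (X i) (δ i))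
    (p : ℕ → Prop) [DecidablePred p] {g : ℝ}
    (hgap : ∀ i ∈ S, p i → ∀ j ∈ S, ¬p j → ∀ y ∈ Δ i, ∀ y' ∈ Δ j, g ≤ ‖y.1 - y'.1‖) :
    ∀ T ⊆ S, |(∫ σ, ∏ i ∈ T, X i σ ∂μ) - (∫ σ, ∏ i ∈ T.filter p, X i σ ∂μ) * (∫ σ, ∏ i ∈ T.filter (fun i => ¬p i), X i σ ∂μ)| ≤
      8 * N * exp (-(t * g)) * ∏ i ∈ T, (M i + ∑ y ∈ Δ i, δ i y) := by
  classical
  intro T hTS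
  have hμ' : IsGibbsMeasure (perturbedYMS (d := d) (fundamentalRep (Fin N)) (N * β) W) μ := hμ
  haveI := hμ'.isProbabilityMeasure
  set Tp := T.filter p with hTp
  set Tq := T.filter (fun i => ¬p i) with hTq
  have hTpS : Tp ⊆ S := (Finset.filter_subset _ _).trans hTS
  have hTqS : Tq ⊆ S := (Finset.filter_subset _ _).trans hTS
  set σ₀ : LGConfig d (Matrix.specialUnitaryGroup (Fin N) ℂ) := fun _ => 1 with hσ₀
  -- data of the two product slots
  have hPm : Measurable fun σ => ∏ i ∈ Tp, X i σ := Finset.measurable_prod _ fun i hi => hXm i (hTpS hi)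
  have hQm : Measurable fun σ => ∏ i ∈ Tq, X i σ := Finset.measurable_prod _ fun i hi => hXm i (hTqS hi)
  have hPdep := dependsOn_prod_slots (T := Tp) fun i hi => hXdep i (hTpS hi)
  have hQdep := dependsOn_prod_slots (T := Tq) fun i hi => hXdep i (hTqS hi)
  have hPM := abs_prod_slots_le (T := Tp) fun i hi => hXM i (hTpS hi)
  have hQM := abs_prod_slots_le (T := Tq) fun i hi => hXM i (hTqS hi)
  obtain ⟨δP, hδP, hδPsum⟩ := exists_isLipBound_prod_slots (fun _ _ => suFrobDist_nonneg _ _) σ₀ (T := Tp)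
    (fun i hi => hXdep i (hTpS hi)) (fun i hi => hXM i (hTpS hi)) fun i hi => hXδ i (hTpS hi)
  obtain ⟨δQ, hδQ, hδQsum⟩ := exists_isLipBound_prod_slots (fun _ _ => suFrobDist_nonneg _ _) σ₀ (T := Tq)
    (fun i hi => hXdep i (hTqS hi)) (fun i hi => hXM i (hTqS hi)) fun i hi => hXδ i (hTqS hi)
  -- the right-hand side
  have hMS0 : ∀ i ∈ T, 0 ≤ M i + ∑ y ∈ Δ i, δ i y := fun i hi =>
    add_nonneg ((abs_nonneg _).trans (hXM i (hTS hi) σ₀)) (Finset.sum_nonneg fun y _ => (hXδ i (hTS hi)).nonneg y)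
  have hprod : ∏ i ∈ T, (M i + ∑ y ∈ Δ i, δ i y) = (∏ i ∈ Tp, (M i + ∑ y ∈ Δ i, δ i y)) * ∏ i ∈ Tq, (M i + ∑ y ∈ Δ i, δ i y) :=
    (Finset.prod_filter_mul_prod_filter_not T p _).symm
  have hRHS0 : 0 ≤ 8 * N * exp (-(t * g)) * ∏ i ∈ T, (M i + ∑ y ∈ Δ i, δ i y) :=
    mul_nonneg (by positivity) (Finset.prod_nonneg hMS0)
  -- the moment of `T` splits as the integral of the product of the two product slots
  have hsplit : (∫ σ, ∏ i ∈ T, X i σ ∂μ) = ∫ σ, (∏ i ∈ Tp, X i σ) * ∏ i ∈ Tq, X i σ ∂μ := by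
    refine integral_congr_ae (ae_of_all _ fun σ => ?_)
    exact (Finset.prod_filter_mul_prod_filter_not T p _).symm
  have hcov : (∫ σ, ∏ i ∈ T, X i σ ∂μ) - (∫ σ, ∏ i ∈ Tp, X i σ ∂μ) * (∫ σ, ∏ i ∈ Tq, X i σ ∂μ) =
      cov[fun σ => ∏ i ∈ Tp, X i σ, fun σ => ∏ i ∈ Tq, X i σ; μ] := by
    rw [hsplit, covariance_eq_sub_of_abs_le hPm hQm hPM hQM]
  rw [hcov]
  -- a constant product slot has no covariance
  by_cases hPne : (Tp.biUnion Δ).Nonempty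
  swap
  · have hconst : (fun σ => ∏ i ∈ Tp, X i σ) = fun _ => ∏ i ∈ Tp, X i σ₀ := by
      funext σ
      rw [Finset.not_nonempty_iff_eq_empty] at hPne
      exact eq_const_of_dependsOn_empty (hPne ▸ hPdep) σ σ₀
    rw [hconst, covariance_const_left]
    simpa only [abs_zero] using hRHS0
  by_cases hQne : (Tq.biUnion Δ).Nonempty
  swap
  · have hconst : (fun σ => ∏ i ∈ Tq, X i σ) = fun _ => ∏ i ∈ Tq, X i σ₀ := by
      funext σ
      rw [Finset.not_nonempty_iff_eq_empty] at hQne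
      exact eq_const_of_dependsOn_empty (hQne ▸ hQdep) σ σ₀
    rw [hconst, covariance_const_right]
    simpa only [abs_zero] using hRHS0
  -- the two supports are `g` apart
  have hdist : g ≤ setDistEdges (Tp.biUnion Δ) (Tq.biUnion Δ) := by
    obtain ⟨u, hu, w, hw, heq⟩ := exists_setDistEdges_eq hPne hQne
    rw [heq]
    obtain ⟨i, hi, hui⟩ := Finset.mem_biUnion.1 hu
    obtain ⟨j, hj, hwj⟩ := Finset.mem_biUnion.1 hw
    exact hgap i (hTpS hi) (Finset.mem_filter.1 hi).2 j (hTqS hj) (Finset.mem_filter.1 hj).2 u hui w hwj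
  -- the pair door's covariance bound
  obtain ⟨BW, hBW⟩ := hW.summable
  obtain ⟨osc, lip, ℓ, hosc, hlip, hoscs, hosca, hlips, hℓ, hℓs, hℓt⟩ := hW.loads
  have h1 := abs_cov_le_of_isLipBound_S hd hN hc hv hb hP hVB hBW hW.continuous hW.dependsOn hosc hoscs hosca hlip hlips hℓ ht hℓs
    hℓt hρ hμ hPm hPdep hPM hδP hQm hQdep hQM hδQ
  have h8N : 2 * (2 * Real.sqrt N) ^ 2 = 8 * N := by rw [mul_pow, Real.sq_sqrt (Nat.cast_nonneg N)]; ring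
  rw [h8N] at h1
  have hδP0 : 0 ≤ ∑ y ∈ Tp.biUnion Δ, δP y := Finset.sum_nonneg fun y _ => hδP.nonneg y
  have hδQ0 : 0 ≤ ∑ y ∈ Tq.biUnion Δ, δQ y := Finset.sum_nonneg fun y _ => hδQ.nonneg y
  have hexp : exp (-(t * setDistEdges (Tp.biUnion Δ) (Tq.biUnion Δ))) ≤ exp (-(t * g)) :=
    exp_le_exp.2 (by nlinarith)
  have hPp0 : 0 ≤ ∏ i ∈ Tp, (M i + ∑ y ∈ Δ i, δ i y) := Finset.prod_nonneg fun i hi => hMS0 i (Finset.filter_subset _ _ hi)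
  have hQp0 : 0 ≤ ∏ i ∈ Tq, (M i + ∑ y ∈ Δ i, δ i y) := Finset.prod_nonneg fun i hi => hMS0 i (Finset.filter_subset _ _ hi)
  calc |cov[fun σ => ∏ i ∈ Tp, X i σ, fun σ => ∏ i ∈ Tq, X i σ; μ]|
      ≤ 8 * N * (∑ y ∈ Tq.biUnion Δ, δQ y) * (∑ y ∈ Tp.biUnion Δ, δP y) * exp (-(t * setDistEdges (Tp.biUnion Δ) (Tq.biUnion Δ))) := h1
    _ ≤ 8 * N * (∏ i ∈ Tq, (M i + ∑ y ∈ Δ i, δ i y)) * (∏ i ∈ Tp, (M i + ∑ y ∈ Δ i, δ i y)) * exp (-(t * g)) := by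
        gcongr
    _ = 8 * N * exp (-(t * g)) * ∏ i ∈ T, (M i + ∑ y ∈ Δ i, δ i y) := by rw [hprod]; ring

/-- **Centring a local Lipschitz observable at the unit configuration**: `σ ↦ h σ − h 1` is local on the same set, has the same Lipschitz vector,
and is bounded by `2√N Σ_Δ δ`. -/
theorem centred_data {h : LGConfig d (Matrix.specialUnitaryGroup (Fin N) ℂ) → ℝ} {Δ : Finset (ZdEdge d)} {δ : ZdEdge d → ℝ}
    (hdep : DependsOn h (↑Δ : Set (ZdEdge d))) (hδ : IsLipBound suFrobDist h δ) :
    DependsOn (fun σ => h σ - h 1) (↑Δ : Set (ZdEdge d)) ∧ IsLipBound suFrobDist (fun σ => h σ - h 1) δ ∧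
      ∀ σ, |h σ - h 1| ≤ 2 * Real.sqrt N * ∑ y ∈ Δ, δ y := by
  classical
  refine ⟨fun σ τ hστ => by simp only [hdep hστ], ⟨hδ.nonneg, fun y σ τ hστ => by
    simpa only [sub_sub_sub_cancel_right] using hδ.le y σ τ hστ⟩, fun σ => ?_⟩
  calc |h σ - h 1| ≤ ∑ y ∈ Δ, δ y * suFrobDist (σ y) ((1 : LGConfig d (Matrix.specialUnitaryGroup (Fin N) ℂ)) y) :=
        abs_sub_le_sum_of_dependsOn hdep hδ σ 1
    _ ≤ ∑ y ∈ Δ, δ y * (2 * Real.sqrt N) := sum_le_sum fun y _ => mul_le_mul_of_nonneg_left (suFrobDist_le _ _) (hδ.nonneg y)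
    _ = 2 * Real.sqrt N * ∑ y ∈ Δ, δ y := by rw [← sum_mul]; ring

end SUN

end Summit.Ventures.YMGap.RobustBall

end
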